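import Mathlib
import Literature.MathematicalPhysics.QuantumFieldTheory.Balaban1983to89.Setup

/-!
# `Balaban1983to89.B14Eq315Repr` — T. Bałaban, *Convergent renormalization expansions for lattice gauge theories*,
# Commun. Math. Phys. **119** (1988) 243–285 [Balaban1988Convergent]: (3.15) pp. 267–268, the representation of
# `(Tρ_k)(V_{k+1})` after the expansion in `A′_k`, the linearization on `Γ_{k+1}`, the removal of the δ-functions by `C`
# and the scaling `A′_k = g_kA_k` — TYPED AS PRINTED (shape), over `Setup`'s densities and abstract step data

statement-level skeleton of published theorems with citation tags; proofs where landed; nothing here is a claim about the Yang–Mills mass gap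

PDF held: `paper:balaban1988-cmp119-convergent-renormalization` (journal page = PDF page + 242); display read on the x2
renders `…-p025-x2.png` (p. 267) and `…-p026-x2.png` (p. 268) of
`run/shared/lean/pub/pub-balaban/b2b-balaban-ref1/pages/1988-cmp119-convergent-renormalization/`.

CITATION HEADER (lean-in-tree rule).  WHAT IS REPRODUCED, verbatim, p. 267–268 [PDF 25–26]: *"The next steps are exactly
the same as in Sect. C [16], and in fact the same as in Sect. 2 [I]. We expand all the expressions with respect to A′_k,
and we linearize the expressions in the δ-functions for bonds in Γ_{k+1}. Finally we remove the δ-functions using the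
operator C, and we perform the scaling transformation A′_k = g_kA_k. All the applied formulas are the same as in Sect. 2
[I], only the symbols represent different operators, determined by the sequence {Ω_j}. Their properties are essentially
the same as before, because of the localization of the field A_k. Let us write the result of these operations.
(Tρ_k)(V_{k+1}) = Σ_{{Ω_j},{Λ_j}} Σ_{Ω_{k+1}} χ_{k+1}(Ω_{k+1}) ∫dV_k|_{Ωᶜ_{k+1}} δ(V̄_kV⁻¹_{k+1}) ζ(Ωᶜ_{k+1})
 · 𝐓_k exp\[A_k(1/g_k², U_{k+1}) + log g_k d(𝐠)|B(Γ_{k+1})*| + log σ₀|B(Γ_{k+1})*| − log z (L⁴ − 1)|Γ_{k+1}|\]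
 z^{(k)} ∫dA_k|_{Ω_{k+1}} χ′_k(Ω_{k+1}) · exp\[−½⟨A_k, C*Δ^{(k)}CA_k⟩ + 𝐏^{(k)}(g_k, U_{k+1}, A_k)
 + {(𝐄_k + 𝐑_k + 𝐁_k)(U_k(exp i\[g_kCA_k − hD̃(g_kCA_k)\]V^{(k)})) − (𝐄_k + 𝐑_k + 𝐁_k)(U_{k+1})
 + A(1/g_k²(·) − 1/g_k², U_k(exp i\[g_kCA_k − hD̃(g_kCA_k)\]V^{(k)})) − A(1/g_k²(·) − 1/g_k², U_{k+1})}\] (3.15)"* —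
SKELETON row **B14.Eq3.15** (cited downstream: [Balaban1989LargeFieldI] pp. 188–189 "(3.15) [III]").

THE TYPED READING (shape level, in the style of `Step.Repr218` for (2.18)).  CONCRETE: the new field `V_{k+1} :
GaugeField P (k+1) G`, densities on `T^{(k)}`/`T^{(k+1)}` (`Setup.Density`), the renormalization transformation `T`
((0.1); e.g. `Setup.RTOpI.T`), the printed constants `g_k`, `d(𝐠)`, `σ₀`, `z`, `L`.  DATA (`Repr315Data`), one entry per
term `a` of the double sum (an admissible `({Ω_j},{Λ_j}; Ω_{k+1})`): the characteristic function `χ_{k+1}(Ω_{k+1})`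
(function of `V_{k+1}`), the partial integration `∫dV_k|_{Ωᶜ_{k+1}} δ(V̄_kV⁻¹_{k+1})(·)` as an operator from functions
of `(V_{k+1}, ψ)` — `ψ : Ψ` = the remaining old variables (`V_k` on `Ωᶜ_{k+1}` and everything `𝐓_k` integrates) — to
densities in `V_{k+1}`, the function `ζ(Ωᶜ_{k+1})`, the operation `𝐓_k`, the action `A_k(1/g_k², U_{k+1})` ((2.23) at
the new background `U_{k+1} = U_{k+1}(V_{k+1}, ψ)`), the counts `|B(Γ_{k+1})*|`, `|Γ_{k+1}|`, the number `z^{(k)}`, the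
fluctuation integral `∫dA_k|_{Ω_{k+1}}(·)` as an operator on functions of `(V_{k+1}, ψ, A_k)` (`A_k : 𝔄`), `χ′_k(Ω_{k+1})`,
the quadratic form `⟨A_k, C*Δ^{(k)}CA_k⟩`, `𝐏^{(k)}`, and the four terms of the curly bracket.  With these the
right-hand side of (3.15) is the DEFINITION `rhs315` and (3.15) is the `Prop` `Eq315 D T ρ_k` = "`Tρ_k` equals it" — a
printed identity (result of the listed operations), typed, NOT proved.  Nothing of the operators `C`, `Δ^{(k)}`, `h`,
`D̃`, of admissibility, or of the bounds is asserted.  Mega-formalization `lit-balaban`, unit `lit-balaban-r11` gen 2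
(Phase-1 typing of the absent row B14.Eq3.15, lead ruling G.5-9), HOME `run/shared/lean/pub/lit-balaban/`.

## References
* [Balaban1988Convergent] T. Bałaban, Commun. Math. Phys. 119 (1988) 243–285, (3.15) pp. 267–268.
-/

noncomputable section

namespace Literature.MathematicalPhysics.QuantumFieldTheory.Balaban1983to89.B14.Eq315Repr

open Literature.MathematicalPhysics.QuantumFieldTheory.Balaban1983to89
open scoped BigOperators

/-- The constituents of the right-hand side of (3.15) pp. 267–268 as DATA (see the module docstring for the dictionary):
index type `Adm` of the double sum `Σ_{{Ω_j},{Λ_j}} Σ_{Ω_{k+1}}`; per index: `chiNext` = χ_{k+1}(Ω_{k+1}), `intVdelta` =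
`∫dV_k|_{Ωᶜ_{k+1}} δ(V̄_kV⁻¹_{k+1})(·)`, `zeta` = ζ(Ωᶜ_{k+1}), `Tk` = 𝐓_k, `Ak` = A_k(1/g_k², U_{k+1}), `nBstar` =
|B(Γ_{k+1})*|, `nGamma` = |Γ_{k+1}|, `zk` = z^{(k)}, `intA` = `∫dA_k|_{Ω_{k+1}}(·)`, `chiPrime` = χ′_k(Ω_{k+1}), `quad A` =
⟨A_k, C*Δ^{(k)}CA_k⟩, `Pk` = 𝐏^{(k)}(g_k, U_{k+1}, A_k), `ERBshift` = (𝐄_k+𝐑_k+𝐁_k)(U_k(exp i\[g_kCA_k − hD̃(g_kCA_k)\]V^{(k)})),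
`ERB` = (𝐄_k+𝐑_k+𝐁_k)(U_{k+1}), `Ashift` = A(1/g_k²(·) − 1/g_k², U_k(exp i\[…\]V^{(k)})), `Aloc` = A(1/g_k²(·) − 1/g_k², U_{k+1}).
`Ψ` = the old variables kept (`V_k|_{Ωᶜ_{k+1}}` and those inside 𝐓_k), `𝔄` = the fluctuation configurations `A_k`.
[cite: Balaban1988Convergent, (3.15) p.267-268] -/
structure Repr315Data (P : Params) (G : Type*) [GaugeGroup G] (k : ℕ) (Ψ : Type*) (𝔄 : Type*) where
  Adm : Type
  [finAdm : Fintype Adm]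
  chiNext : Adm → Density P (k+1) G
  intVdelta : Adm → (GaugeField P (k+1) G → Ψ → ℝ) → Density P (k+1) G
  zeta : Adm → GaugeField P (k+1) G → Ψ → ℝ
  Tk : Adm → (GaugeField P (k+1) G → Ψ → ℝ) → (GaugeField P (k+1) G → Ψ → ℝ)
  Ak : Adm → GaugeField P (k+1) G → Ψ → ℝ
  nBstar : Adm → ℕ
  nGamma : Adm → ℕ
  zk : Adm → ℝ
  intA : Adm → (GaugeField P (k+1) G → Ψ → 𝔄 → ℝ) → (GaugeField P (k+1) G → Ψ → ℝ)
  chiPrime : Adm → GaugeField P (k+1) G → Ψ → 𝔄 → ℝ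
  quad : Adm → 𝔄 → ℝ
  Pk : Adm → GaugeField P (k+1) G → Ψ → 𝔄 → ℝ
  ERBshift : Adm → GaugeField P (k+1) G → Ψ → 𝔄 → ℝ
  ERB : Adm → GaugeField P (k+1) G → Ψ → ℝ
  Ashift : Adm → GaugeField P (k+1) G → Ψ → 𝔄 → ℝ
  Aloc : Adm → GaugeField P (k+1) G → Ψ → ℝ

variable {P : Params} {G : Type*} [GaugeGroup G] {k : ℕ} {Ψ 𝔄 : Type*}

/-- The index type of the double sum of (3.15) is finite (field `finAdm`), registered so that the sum elaborates. [folklore] -/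
instance Repr315Data.instFintypeAdm (D : Repr315Data P G k Ψ 𝔄) : Fintype D.Adm := D.finAdm

/-- The exponent under `𝐓_k` in (3.15): `A_k(1/g_k², U_{k+1}) + log g_k d(𝐠)|B(Γ_{k+1})*| + log σ₀|B(Γ_{k+1})*| −
log z (L⁴ − 1)|Γ_{k+1}|` (`dg` = d(𝐠) the dimension of the Lie algebra; `L⁴` as printed, d = 4).
[cite: Balaban1988Convergent, (3.15) p.267] -/
def expo315 (D : Repr315Data P G k Ψ 𝔄) (gk σ₀ z : ℝ) (dg L : ℕ) (a : D.Adm) (V : GaugeField P (k+1) G) (ψ : Ψ) : ℝ :=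
  D.Ak a V ψ + Real.log gk * (dg : ℝ) * (D.nBstar a : ℝ) + Real.log σ₀ * (D.nBstar a : ℝ)
    - Real.log z * ((L : ℝ) ^ 4 - 1) * (D.nGamma a : ℝ)

/-- The fluctuation integrand of (3.15) (second exponential with `χ′_k(Ω_{k+1})`):
`χ′_k(Ω_{k+1}) exp\[−½⟨A_k, C*Δ^{(k)}CA_k⟩ + 𝐏^{(k)}(g_k, U_{k+1}, A_k) + {(𝐄_k+𝐑_k+𝐁_k)(U_k(e^{i[…]}V^{(k)})) −
(𝐄_k+𝐑_k+𝐁_k)(U_{k+1}) + A(1/g_k²(·) − 1/g_k², U_k(e^{i[…]}V^{(k)})) − A(1/g_k²(·) − 1/g_k², U_{k+1})}\]`.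
[cite: Balaban1988Convergent, (3.15) p.267-268] -/
def fluct315 (D : Repr315Data P G k Ψ 𝔄) (a : D.Adm) (V : GaugeField P (k+1) G) (ψ : Ψ) (A : 𝔄) : ℝ :=
  D.chiPrime a V ψ A *
    Real.exp (-(1 / 2 : ℝ) * D.quad a A + D.Pk a V ψ A +
      (D.ERBshift a V ψ A - D.ERB a V ψ + D.Ashift a V ψ A - D.Aloc a V ψ))

/-- **The right-hand side of (3.15)** pp. 267–268: `Σ_a χ_{k+1}(Ω_{k+1})(V_{k+1}) · ∫dV_k|_{Ωᶜ_{k+1}} δ(V̄_kV⁻¹_{k+1})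
ζ(Ωᶜ_{k+1}) 𝐓_k( exp\[expo315\] · z^{(k)} · ∫dA_k|_{Ω_{k+1}} fluct315 )`. [cite: Balaban1988Convergent, (3.15) p.267-268] -/
def rhs315 (D : Repr315Data P G k Ψ 𝔄) (gk σ₀ z : ℝ) (dg L : ℕ) : Density P (k+1) G :=
  fun V => ∑ a : D.Adm, D.chiNext a V *
    D.intVdelta a (fun W ψ => D.zeta a W ψ *
      D.Tk a (fun W' ψ' => Real.exp (expo315 D gk σ₀ z dg L a W' ψ') * D.zk a *
        D.intA a (fluct315 D a) W' ψ') W ψ) V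

/-- **(3.15)** pp. 267–268 [PDF 25–26] (text verbatim in the module docstring): *"Let us write the result of these
operations. (Tρ_k)(V_{k+1}) = Σ_{{Ω_j},{Λ_j}} Σ_{Ω_{k+1}} χ_{k+1}(Ω_{k+1}) ∫dV_k|_{Ωᶜ_{k+1}} δ(V̄_kV⁻¹_{k+1}) ζ(Ωᶜ_{k+1}) ·
𝐓_k exp\[…\] z^{(k)} ∫dA_k|_{Ω_{k+1}} χ′_k(Ω_{k+1}) · exp\[…\] (3.15)"* — typed reading: for the renormalization
transformation `T` ((0.1)) and the k-th density `ρ_k`, `Tρ_k = rhs315` pointwise in `V_{k+1}`, with `g_k` the running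
coupling, `d(𝐠)` the Lie-algebra dimension, `σ₀`, `z` the printed normalization numbers and `L` the scale factor.  A
printed identity ("the result of these operations"), typed, NOT proved here. [cite: Balaban1988Convergent, (3.15) p.267-268] -/
def Eq315 (D : Repr315Data P G k Ψ 𝔄) (T : Density P k G → Density P (k+1) G) (ρk : Density P k G)
    (gk σ₀ z : ℝ) (dg L : ℕ) : Prop :=
  ∀ V : GaugeField P (k+1) G, T ρk V = rhs315 D gk σ₀ z dg L V

/-- Reading aid for (3.15): the exponent under `𝐓_k` splits as the action plus the three VOLUME constants, so
`exp\[expo315\] = exp\[A_k\] · g_k^{d(𝐠)|B(Γ_{k+1})*|} · σ₀^{|B(Γ_{k+1})*|} · z^{−(L⁴−1)|Γ_{k+1}|}` for positive `g_k`,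
`σ₀`, `z` (the constants "log g_k d(𝐠)|B(Γ_{k+1})*|", "log σ₀|B(Γ_{k+1})*|", "−log z (L⁴ − 1)|Γ_{k+1}|" are logarithms of
the normalization factors produced by the scaling, the σ₀-measure and the gauge fixing). PROVED (real `exp`/`log`
algebra, `Real.rpow`). [cite: Balaban1988Convergent, (3.15) p.267] -/
theorem exp_expo315 (D : Repr315Data P G k Ψ 𝔄) {gk σ₀ z : ℝ} (hg : 0 < gk) (hσ : 0 < σ₀) (hz : 0 < z)
    (dg L : ℕ) (a : D.Adm) (V : GaugeField P (k+1) G) (ψ : Ψ) :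
    Real.exp (expo315 D gk σ₀ z dg L a V ψ) =
      Real.exp (D.Ak a V ψ) * gk ^ ((dg : ℝ) * (D.nBstar a : ℝ)) * σ₀ ^ (D.nBstar a : ℝ) *
        z ^ (-(((L : ℝ) ^ 4 - 1) * (D.nGamma a : ℝ))) := by
  unfold expo315
  rw [Real.rpow_def_of_pos hg, Real.rpow_def_of_pos hσ, Real.rpow_def_of_pos hz, ← Real.exp_add, ← Real.exp_add,
    ← Real.exp_add]
  congr 1
  ring

end Literature.MathematicalPhysics.QuantumFieldTheory.Balaban1983to89.B14.Eq315Repr
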